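import Literature.AnabelianGeometry.SemiGraphs.ProSigmaCompletionSlim
import Literature.AnabelianGeometry.SemiGraphs.SurfaceTypeSlim
import Literature.GroupTheory.CombinatorialGroupTheory.PuncturedSurfaceGroupFree
import HarnessLib

/-!
# Verticial slimness input for [SemiAnbd] Example 2.10: punctured surface groups

[SemiAnbd] Example 2.10 (p. 31): a semi-graph of anabelioids of a pointed stable curve — each vertex
group "the maximal pro-`Σ` quotient of the fundamental group of a hyperbolic Riemann surface of finite
type", i.e. a pro-`Σ` completion of a punctured surface group `Γ_{g,r}`, `2g − 2 + r > 0` — is, among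
other things, *verticially slim* ("cf. the proof of [Mzk3], Lemma 1.3.1")
[cite: MochizukiSemiAnbd2006, Ex. 2.10 p.31]; [AbsAnab] Lemma 1.3.1 (p. 15): the geometric fundamental
group of a hyperbolic curve is slim [cite: MochizukiAbsAnab2004, Lemma 1.3.1 p.15].

This file records the group-theoretic input in the shape consumed by abc-iut-L3-t11's
`example_2_10_verticiallySlim` (row G31 (5)), over abc-iut-L3-t1's `IsProSigmaCompletion` and
`PuncturedSurfaceGroup` VERBATIM:

* `isSlimGroup_of_isProSigmaCompletion` — a pro-`Σ` completion of a nonabelian free group is slim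
  (`ProSigmaCompletionSlim.lean`);
* `isSlimGroup_of_isProSigmaCompletion_puncturedSurfaceGroup` — the PUNCTURED case `r ≥ 1` of a
  hyperbolic type `(g, r)`: `Γ_{g,r}` is then a nonabelian free group (`PuncturedSurfaceGroupFree.lean`),
  so every pro-`Σ` completion of it is slim;
* `proSigmaSurfaceGroupSlim_of_closed` — abc-iut-L3-t11's named fact `ProSigmaSurfaceGroupSlim`
  (`SurfaceTypeSlim.lean`, all hyperbolic `(g, r)`) REDUCED to its closed-surface case `r = 0`, `g ≥ 2`
  (taken as an inline hypothesis), and hence `example_2_10_verticiallySlim_of_closed`: [SemiAnbd]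
  Ex. 2.10 conjunct (5) for every semi-graph of anabelioids of surface type, modulo that case only.

Honest scope: the PROPER case `r = 0` (closed surface groups, genus `≥ 2`) is NOT covered — it needs
the structure of finite-index subgroups of surface groups / cohomological dimension `2`, absent from
the tree; `P` is any compact Hausdorff totally disconnected topological group (e.g. `Aut F` of a fibre
functor).  No hypothesis on `Σ` is needed.  Theorems only; no side is taken on [IUTchIII] Cor. 3.12.
-/

namespace Literature.AnabelianGeometry.SemiGraphs.SemiGraphOfAnabelioids

open Literature.AlgebraicGeometry.Frobenioids Literature.GroupTheory.CombinatorialGroupTheory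

universe u v v₁ u₁

/-- **Pro-`Σ` completions of nonabelian free groups are slim** ([AbsAnab] Lemma 1.3.1, affine case;
[SemiAnbd] Ex. 2.10 "verticially slim"): for `Γ` free (`IsFreeGroup`, any rank) and nonabelian,
`P` a profinite (compact, Hausdorff, totally disconnected) topological group and `ι : Γ → P` with
`IsProSigmaCompletion Sigma ι`, the centralizer of every open subgroup of `P` is trivial.
[cite: MochizukiAbsAnab2004, Lemma 1.3.1 p.15] -/
theorem isSlimGroup_of_isProSigmaCompletion {Sigma : Set ℕ} {Γ : Type u} [Group Γ] [IsFreeGroup Γ]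
    (hΓ : ∃ x y : Γ, x * y ≠ y * x) {P : Type v} [Group P] [TopologicalSpace P]
    [IsTopologicalGroup P] [CompactSpace P] [T2Space P] [TotallyDisconnectedSpace P]
    (ι : Γ →* P) (hι : IsProSigmaCompletion Sigma ι) : IsSlimGroup P :=
  hι.isSlimGroup hΓ

/-- **Verticial slimness input, punctured case**: for a hyperbolic type `(g, r)` with `r ≥ 1`, every
pro-`Σ` completion `ι : Γ_{g,r} → P` (`P` compact Hausdorff totally disconnected, e.g. `Π_v = Aut F`)
of the punctured surface group `Γ_{g,r} = PuncturedSurfaceGroup g r` is slim.  (`Γ_{g,r}` is free of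
rank `2g + r − 1 ≥ 2`.)  [SemiAnbd] Ex. 2.10 "verticially slim [cf. the proof of [Mzk3], Lemma
1.3.1]". [cite: MochizukiSemiAnbd2006, Ex. 2.10 p.31] -/
theorem isSlimGroup_of_isProSigmaCompletion_puncturedSurfaceGroup {Sigma : Set ℕ} {g r : ℕ}
    (hr : 1 ≤ r) (h : PuncturedSurfaceGroup.IsHyperbolicType g r) {P : Type v} [Group P]
    [TopologicalSpace P] [IsTopologicalGroup P] [CompactSpace P] [T2Space P]
    [TotallyDisconnectedSpace P] (ι : PuncturedSurfaceGroup g r →* P)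
    (hι : IsProSigmaCompletion Sigma ι) : IsSlimGroup P := by
  obtain ⟨r', rfl⟩ : ∃ r', r = r' + 1 := ⟨r - 1, by omega⟩
  obtain ⟨e⟩ := PuncturedSurfaceGroup.nonempty_mulEquiv_freeGroup g r'
  haveI : IsFreeGroup (PuncturedSurfaceGroup g (r' + 1)) := IsFreeGroup.ofMulEquiv e.symm
  exact hι.isSlimGroup (PuncturedSurfaceGroup.exists_mul_ne_mul h)

/-- The center of such a completion is trivial (special case of slimness, recorded for convenience).
[cite: MochizukiAbsAnab2004, Lemma 1.3.1 p.15] -/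
theorem center_eq_bot_of_isProSigmaCompletion_puncturedSurfaceGroup {Sigma : Set ℕ} {g r : ℕ}
    (hr : 1 ≤ r) (h : PuncturedSurfaceGroup.IsHyperbolicType g r) {P : Type v} [Group P]
    [TopologicalSpace P] [IsTopologicalGroup P] [CompactSpace P] [T2Space P]
    [TotallyDisconnectedSpace P] (ι : PuncturedSurfaceGroup g r →* P)
    (hι : IsProSigmaCompletion Sigma ι) : Subgroup.center P = ⊥ := by
  have hs := isSlimGroup_of_isProSigmaCompletion_puncturedSurfaceGroup hr h ι hι
  rw [eq_bot_iff]
  intro z hz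
  have h1 := hs.centralizer_eq_bot ⊤ isOpen_univ
  rw [← h1]
  exact Subgroup.mem_centralizer_iff.mpr fun w _ => (Subgroup.mem_center_iff.mp hz w)

/-! ### Reduction of `ProSigmaSurfaceGroupSlim` to the closed-surface case -/

/-- **`ProSigmaSurfaceGroupSlim` modulo the closed-surface case.**  abc-iut-L3-t11's named fact (slimness
of pro-`Σ` completions of `Γ_{g,r}` for every hyperbolic `(g, r)`, `SurfaceTypeSlim.lean`) follows from
its case `r = 0` (then `g ≥ 2`), the punctured case `r ≥ 1` being
`isSlimGroup_of_isProSigmaCompletion_puncturedSurfaceGroup`.  The hypothesis `h0` is [AbsAnab] Lemma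
1.3.1 for PROPER curves in pro-`Σ` form — not proved in the tree (it needs the cohomological dimension /
finite-index-subgroup structure of surface groups). [cite: MochizukiAbsAnab2004, Lemma 1.3.1 p.15] -/
theorem proSigmaSurfaceGroupSlim_of_closed
    (h0 : ∀ (Sigma : Set ℕ), Sigma.Nonempty → (∀ p ∈ Sigma, p.Prime) → ∀ (g : ℕ), 2 ≤ g →
      ∀ (P : Type v) [Group P] [TopologicalSpace P] [IsTopologicalGroup P] [CompactSpace P]
        [T2Space P] [TotallyDisconnectedSpace P] (ι : PuncturedSurfaceGroup g 0 →* P),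
        IsProSigmaCompletion Sigma ι → IsSlimGroup P) :
    ProSigmaSurfaceGroupSlim.{v} := by
  intro Sigma hne hprime g r hhyp P _ _ _ _ _ _ ι hι
  rcases Nat.eq_zero_or_pos r with hr | hr
  · subst hr
    have hg : 2 ≤ g := by
      unfold PuncturedSurfaceGroup.IsHyperbolicType at hhyp
      omega
    exact h0 Sigma hne hprime g hg P ι hι
  · exact isSlimGroup_of_isProSigmaCompletion_puncturedSurfaceGroup hr hhyp ι hι

/-- **[SemiAnbd] Example 2.10, conjunct (5), modulo the closed-surface case only**: every semi-graph of
anabelioids of surface type is verticially slim, granted slimness of pro-`Σ` completions of closed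
surface groups of genus `≥ 2` (abc-iut-L3-t11's `example_2_10_verticiallySlim_of` composed with
`proSigmaSurfaceGroupSlim_of_closed`; vertices carrying a branch are punctured and need no hypothesis).
[cite: MochizukiSemiAnbd2006, Ex. 2.10 p.31] -/
theorem example_2_10_verticiallySlim_of_closed
    (h0 : ∀ (Sigma : Set ℕ), Sigma.Nonempty → (∀ p ∈ Sigma, p.Prime) → ∀ (g : ℕ), 2 ≤ g →
      ∀ (P : Type (max u₁ v₁)) [Group P] [TopologicalSpace P] [IsTopologicalGroup P] [CompactSpace P]
        [T2Space P] [TotallyDisconnectedSpace P] (ι : PuncturedSurfaceGroup g 0 →* P),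
        IsProSigmaCompletion Sigma ι → IsSlimGroup P)
    (𝒢 : SemiGraphOfAnabelioids.{v₁, u₁, u}) (Sigma : Set ℕ) (hS : 𝒢.IsOfSurfaceType Sigma) :
    𝒢.IsVerticiallySlim :=
  example_2_10_verticiallySlim_of (proSigmaSurfaceGroupSlim_of_closed h0) 𝒢 Sigma hS

end Literature.AnabelianGeometry.SemiGraphs.SemiGraphOfAnabelioids
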